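import Mathlib
import HarnessLib
import Summits.RiemannHypothesis.RiemannHypothesis.Theorems.IntegerScrewPivotCriterion
import Summits.RiemannHypothesis.RiemannHypothesis.Theorems.IntegerScrewRungCertFast
import Summits.RiemannHypothesis.RiemannHypothesis.Theorems.IntegerScrewRung64Data

/-!
# Route `IntegerScrew` — THE RUNGS `d_2, …, d_64 > 0` UNCONDITIONALLY: `S_64 ≻ 0` by kernel certificate

`screwMatrix 63 = S_64 = [G(log m, log m')]_{2 ≤ m, m' ≤ 64}` is positive definite: the whole range of the
cell's exact SOS census (HOME/sos/SOS-CENSUS.md, engine A: exact pivots `m ≤ 64`) as a kernel theorem. The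
table identity `utab63 = uTableK logs63 slope63 63 ktab63` is decided in three row chunks (`ztab63_0/1/2`:
rows `< 42`, `< 54`, rest — a single `decide` of the 2 016-entry identity does not reduce on the farm),
glued by `List.take_append_drop`; the slope literal by `slope63_eq`; the integer domination test by
`rungCheckZ_63` — all `decide +kernel`, standard axioms, ≈ 100 s in all. Consequences:
`screwMatrix_posDef_63`, `screwPivot_pos_of_le_64 : 2 ≤ M → M ≤ 64 → 0 < screwPivot M`,
`screwMatrix_posDef_of_le_63`, `riemannHypothesis_iff_screwPivot_pos_ge_65` (RH ⟺ ∀ M ≥ 65, d_M > 0).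
Certified bound: `λ_min(T(c_lo)) ≥ lamZ63/2^49 = 0.0036279` (`·64 = 0.2322`; census `0.235392…`). Nothing
here bears on the truth of RH (an RH-consequence made unconditional by computation). Reference: M. Suzuki,
J. Lond. Math. Soc. (2) 108 (2023) = arXiv:2206.03682, Thm 1.2, (1.1), (1.4) [Suzuki2023].
-/

set_option linter.dupNamespace false

namespace Summit.RiemannHypothesis.RiemannHypothesis.Theorems.IntegerScrew

open RungCert Literature.Analysis.ValidatedNumerics Literature.Analysis.ValidatedNumerics.Numerics

set_option maxRecDepth 200000 in
/-- The slope literal is the engine's enclosure (kernel). [folklore] -/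
theorem RungCert.slope63_eq : slopeEncl logs63 = some slope63 := by
  decide +kernel

set_option maxRecDepth 200000 in
set_option maxHeartbeats 0 in
/-- Table identity, row chunk 0 (kernel). [folklore] -/
theorem RungCert.ztab63_0 : utab63.take 42 = (uTableK logs63 slope63 63 ktab63).take 42 := by
  decide +kernel

set_option maxRecDepth 200000 in
set_option maxHeartbeats 0 in
/-- Table identity, row chunk 1 (kernel). [folklore] -/
theorem RungCert.ztab63_1 : (utab63.drop 42).take 12 = ((uTableK logs63 slope63 63 ktab63).drop 42).take 12 := by
  decide +kernel

set_option maxRecDepth 200000 in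
set_option maxHeartbeats 0 in
/-- Table identity, row chunk 2 (kernel). [folklore] -/
theorem RungCert.ztab63_2 : utab63.drop 54 = (uTableK logs63 slope63 63 ktab63).drop 54 := by
  decide +kernel

/-- Gluing three chunks of a list identity. [folklore] -/
theorem RungCert.list_eq_of_chunks₃ {α : Type*} {l m : List α} (a b : ℕ) (h1 : l.take a = m.take a)
    (h2 : (l.drop a).take b = (m.drop a).take b) (h3 : l.drop (a + b) = m.drop (a + b)) : l = m := by
  rw [← List.take_append_drop a l, ← List.take_append_drop a m, h1]
  congr 1
  rw [← List.take_append_drop b (l.drop a), ← List.take_append_drop b (m.drop a), h2,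
    List.drop_drop, List.drop_drop, h3]

/-- **The table identity** `utab63 = uTableK logs63 slope63 63 ktab63`. [folklore] -/
theorem RungCert.utab63_eq : utab63 = uTableK logs63 slope63 63 ktab63 :=
  list_eq_of_chunks₃ 42 12 ztab63_0 ztab63_1 ztab63_2

set_option maxRecDepth 200000 in
set_option maxHeartbeats 0 in
/-- **The kernel computation**: the integer rung certificate for `S_64` passes. [folklore] -/
theorem RungCert.rungCheckZ_63 : rungCheckZ 63 logs63 utab63 lz63 lamZ63 = true := by
  decide +kernel

/-- **`S_64 ≻ 0`, unconditionally** (`screwMatrix 63` = the `63 × 63` screw Gram matrix on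
`log 2, …, log 64`). [folklore] -/
theorem screwMatrix_posDef_63 : (screwMatrix 63).PosDef :=
  posDef_of_rungCheckZ RungCert.rungCheckZ_63 RungCert.slope63_eq RungCert.utab63_eq

/-- **The rungs `d_M > 0` for `2 ≤ M ≤ 64`, unconditionally.** [folklore] -/
theorem screwPivot_pos_of_le_64 {M : ℕ} (hM : 2 ≤ M) (hM' : M ≤ 64) : 0 < screwPivot M :=
  screwPivot_pos_of_posDef_le screwMatrix_posDef_63 M hM hM'

/-- `S_M ≻ 0` for every `M ≤ 64` (all leading blocks). [folklore] -/
theorem screwMatrix_posDef_of_le_63 {n : ℕ} (hn : n ≤ 63) : (screwMatrix n).PosDef :=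
  screwMatrix_posDef_of_le hn screwMatrix_posDef_63

/-- **RH ⟺ every pivot from the 65-th on is positive**: the rungs `d_2, …, d_64 > 0` are discharged
above, so the pivot criterion `riemannHypothesis_iff_screwPivot_pos` (`RH ↔ ∀ M ≥ 2, d_M > 0`) loses its
first 63 clauses. An RH-EQUIVALENCE, not progress on RH. [folklore] -/
theorem riemannHypothesis_iff_screwPivot_pos_ge_65 :
    _root_.RiemannHypothesis ↔ ∀ M : ℕ, 65 ≤ M → 0 < screwPivot M := by
  rw [riemannHypothesis_iff_screwPivot_pos]
  refine ⟨fun h M hM => h M (by omega), fun h M hM => ?_⟩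
  by_cases hM' : M ≤ 64
  · exact screwPivot_pos_of_le_64 hM hM'
  · exact h M (by omega)

end Summit.RiemannHypothesis.RiemannHypothesis.Theorems.IntegerScrew
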